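import Literature.MathematicalPhysics.QuantumLattice.BoundedWilsonFlowLift
import Mathlib.Analysis.ODE.ExistUnique
import Mathlib.Analysis.SpecialFunctions.Exponential
import Mathlib.Analysis.Calculus.Deriv.Star
import Mathlib.Analysis.Calculus.Deriv.Mul
import Mathlib.Analysis.Calculus.Deriv.Prod
import HarnessLib

/-!
# The Wilson flow on a finite lattice: global existence, unitarity, continuity in the data

Topic `Literature/MathematicalPhysics/QuantumLattice`; settles the debt recorded under "Deliberately
NOT here" in `LatticeWilsonFlow.lean` / `BoundedWilsonFlowLift.lean`: for a matrix group `H ⊆ U(N)`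
(in every use `H = range ρ` for a unitary lattice representation `ρ : G →* M_N(ℂ)`) and unitary
initial link matrices on a FINITE lattice (site type `Fin d → R`, `R` finite, e.g. the discrete
torus `R = ZMod S` of `GaugeConfig d S G`), Lüscher's flow equation (1.4)
`V̇_t(e) = −π_𝔤(Ω_e(V_t)) V_t(e)` has a global flow line (all real times), the flow line stays
unitary, and the tree's flow `V ↦ matrixWilsonFlow H t V` is continuous on the unitary fields.
The gauge-group level consequences (continuity of `U ↦ flowedEnergy ρ t x U` and of the bounded
flowed density of periodic lifts) are in `TorusWilsonFlowContinuity.lean`.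

**Source.** M. Lüscher, JHEP 08 (2010) 071 [Luscher2010], §1 p. 2: "The existence, uniqueness and
smoothness of the Wilson flow at all positive and negative times `t` is rigorously guaranteed on a
finite lattice"; App. C (C.1): `V̇_t = Z(V_t) V_t` with `Z` in the Lie algebra of the gauge group.
The proof is the textbook one (the tree's `QuantumFieldTheory/WilsonFlow.lean` does it for `SU(n)`):
(i) a generator `X` of a one-parameter subgroup `t ↦ exp(tX)` of `H ⊆ U(N)` satisfies
`exp(tX)† exp(tX) = 1`, whose derivative at `0` is `X† + X = 0`, so the span `matrixLieAlgebra H`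
and `π_𝔤 W`, `Z(V)(e)` are skew-Hermitian (`conjTranspose_lieProjection`); (ii) along a solution
of `Ȧ = X(τ)A` with `X(τ)` skew-Hermitian `A†A` is constant (`mem_unitaryGroup_of_hasDerivWithinAt`);
(iii) the field of (1.4) is bounded and Lipschitz on balls (tree: `norm_wilsonFlowField_le`,
`norm_wilsonFlowField_sub_le`), so times the `1`-Lipschitz cut-off `χ(W) = clamp(N + 2 − ‖W‖)`
it is globally Lipschitz, bounded, and unchanged where `‖W‖ ≤ N + 1` ⊇ unitary fields
(`exists_lipschitz_cutoff`); Mathlib's Picard–Lindelöf (`IsPicardLindelof`) gives solutions on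
every `[−T, T]`, Lipschitz in the initial point, which stay unitary by (ii), hence solve the true
equation, and patch to a global flow line by ODE uniqueness (`exists_unitary_wilsonFlowLine`); (iv) by
uniqueness on a finite lattice (tree: `IsWilsonFlowLine.eq_matrixWilsonFlow`) the tree's
`matrixWilsonFlow H t` is this flow on unitary fields (`exists_isWilsonFlowLine_of_unitary`,
`matrixWilsonFlow_mem_unitaryGroup`, `continuousOn_matrixWilsonFlow`).
Everything stated is proved; theorems only. Norms: Frobenius per link (`Matrix.Norms.Frobenius`,
the norm of the tree's `frobeniusInnerProductSpace`), sup over links.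

Deliberately NOT here: the group law, joint continuity in `(t, V)`, smoothness in `V`,
monotonicity of the Wilson action, gauge covariance, the identification of `matrixLieAlgebra`.

## References

* M. Lüscher, *Properties and uses of the Wilson flow in lattice QCD*, JHEP 08 (2010) 071,
  arXiv:1006.4518, eq. (1.4), §1 p. 2, App. C (C.1). [Luscher2010]
-/

noncomputable section

open scoped Matrix.Norms.Frobenius NNReal Topology
open Matrix Set Filter Metric

namespace Literature.MathematicalPhysics.QuantumLattice

/-! ### Generators of one-parameter subgroups of a unitary matrix group are skew-Hermitian -/

section SkewHermitian

variable {N : ℕ}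

/-- If `H ⊆ U(N)` then every generator `X` of a one-parameter subgroup `t ↦ exp(tX)` of `H` is
skew-Hermitian, `X† = −X`: differentiate `exp(tX)† exp(tX) = 1` at `t = 0`. [folklore] -/
theorem conjTranspose_eq_neg_of_mem_oneParamGenerators {H : Set (Matrix (Fin N) (Fin N) ℂ)}
    (hH : ∀ A ∈ H, A ∈ Matrix.unitaryGroup (Fin N) ℂ) {X : Matrix (Fin N) (Fin N) ℂ}
    (hX : X ∈ oneParamGenerators H) : Xᴴ = -X := by
  have hconst : ∀ u : ℝ, star (NormedSpace.exp (u • X)) * NormedSpace.exp (u • X) = 1 := fun u =>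
    Matrix.mem_unitaryGroup_iff'.1 (hH _ (hX u))
  have h1 := hasDerivAt_exp_smul_const X (0 : ℝ)
  have h2 := (h1.star).fun_mul h1
  have h3 := h2.unique
    ((hasDerivAt_const (0 : ℝ) (1 : Matrix (Fin N) (Fin N) ℂ)).congr_of_eventuallyEq
      (Eventually.of_forall fun u => hconst u))
  simp only [zero_smul, NormedSpace.exp_zero, one_mul, mul_one, star_one] at h3
  rw [← star_eq_conjTranspose, eq_neg_iff_add_eq_zero, h3]

/-- If `H ⊆ U(N)`, the Lie algebra `matrixLieAlgebra H` (the real span of the generators) consists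
of skew-Hermitian matrices. [folklore] -/
theorem conjTranspose_eq_neg_of_mem_matrixLieAlgebra {H : Set (Matrix (Fin N) (Fin N) ℂ)}
    (hH : ∀ A ∈ H, A ∈ Matrix.unitaryGroup (Fin N) ℂ) {X : Matrix (Fin N) (Fin N) ℂ}
    (hX : X ∈ matrixLieAlgebra H) : Xᴴ = -X := by
  change X ∈ Submodule.span ℝ (oneParamGenerators H) at hX
  induction hX using Submodule.span_induction with
  | mem Y hY => exact conjTranspose_eq_neg_of_mem_oneParamGenerators hH hY
  | zero => rw [conjTranspose_zero, neg_zero]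
  | add Y Z _ _ hY hZ => rw [conjTranspose_add, hY, hZ, neg_add]
  | smul c Y _ hY => rw [conjTranspose_smul, star_trivial, hY, smul_neg]

/-- If `H ⊆ U(N)`, the projection `π_𝔤 W` is skew-Hermitian for every `W`. [folklore] -/
theorem conjTranspose_lieProjection {H : Set (Matrix (Fin N) (Fin N) ℂ)}
    (hH : ∀ A ∈ H, A ∈ Matrix.unitaryGroup (Fin N) ℂ) (W : Matrix (Fin N) (Fin N) ℂ) :
    (lieProjection H W)ᴴ = -lieProjection H W :=
  conjTranspose_eq_neg_of_mem_matrixLieAlgebra hH (lieProjection_mem H W)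

/-- If `H ⊆ U(N)`, Lüscher's generator `Z(V)(e) = −π_𝔤 Ω_e(V)` is skew-Hermitian (App. C: `Z` takes
values in the Lie algebra of the gauge group). [cite: Luscher2010, App. C eq. (C.1)] -/
theorem conjTranspose_wilsonFlowGenerator {d : ℕ} {R : Type*} [AddGroup R] [One R]
    {H : Set (Matrix (Fin N) (Fin N) ℂ)} (hH : ∀ A ∈ H, A ∈ Matrix.unitaryGroup (Fin N) ℂ)
    (V : MatrixLinkField d R N) (e : (Fin d → R) × Fin d) :
    (wilsonFlowGenerator H V e)ᴴ = -wilsonFlowGenerator H V e := by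
  rw [wilsonFlowGenerator, conjTranspose_neg, conjTranspose_lieProjection hH]

/-- **Invariance of `U(N)`**: a matrix curve on an interval solving `Ȧ = X(τ) A` with every `X(τ)`
skew-Hermitian, unitary at one time, is unitary at all times of the interval
(`d/dτ (A†A) = A†(X† + X)A = 0`). [folklore] -/
theorem mem_unitaryGroup_of_hasDerivWithinAt {A X : ℝ → Matrix (Fin N) (Fin N) ℂ} {a b t₀ : ℝ}
    (ht₀ : t₀ ∈ Icc a b) (hA : ∀ τ ∈ Icc a b, HasDerivWithinAt A (X τ * A τ) (Icc a b) τ)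
    (hX : ∀ τ ∈ Icc a b, (X τ)ᴴ = -X τ) (h0 : A t₀ ∈ Matrix.unitaryGroup (Fin N) ℂ) {τ : ℝ}
    (hτ : τ ∈ Icc a b) : A τ ∈ Matrix.unitaryGroup (Fin N) ℂ := by
  have hd : ∀ s ∈ Icc a b, HasDerivWithinAt (fun s => star (A s) * A s) 0 (Icc a b) s :=
    fun s hs => (((hA s hs).star).fun_mul (hA s hs)).congr_deriv (by
      simp only [star_eq_conjTranspose, conjTranspose_mul, hX s hs, Matrix.neg_mul,
        Matrix.mul_neg, Matrix.mul_assoc, neg_add_cancel])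
  have key := (convex_Icc a b).norm_image_sub_le_of_norm_hasDerivWithin_le (f' := fun _ => 0) hd
    (fun _ _ => by rw [norm_zero]) ht₀ hτ
  simp only [zero_mul, norm_le_zero_iff, sub_eq_zero] at key
  rw [Matrix.mem_unitaryGroup_iff', key]
  exact Matrix.mem_unitaryGroup_iff'.1 h0

/-- Entries of a differentiable matrix-valued curve are differentiable (the entry is a continuous
real-linear functional). [folklore] -/
theorem hasDerivAt_apply_entry {f : ℝ → Matrix (Fin N) (Fin N) ℂ} {f' : Matrix (Fin N) (Fin N) ℂ}
    {t : ℝ} (h : HasDerivAt f f' t) (i j : Fin N) :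
    HasDerivAt (fun τ => f τ i j) (f' i j) t :=
  (({ Matrix.entryLinearMap ℝ ℂ i j with
      cont := (continuous_apply j).comp (continuous_apply i) } :
      Matrix (Fin N) (Fin N) ℂ →L[ℝ] ℂ).hasFDerivAt).comp_hasDerivAt t h

/-- A unitary matrix has Frobenius norm `≤ N` (all entries have modulus `≤ 1`). [folklore] -/
theorem norm_le_of_mem_unitaryGroup {A : Matrix (Fin N) (Fin N) ℂ}
    (hA : A ∈ Matrix.unitaryGroup (Fin N) ℂ) : ‖A‖ ≤ N := by
  have h := frobenius_norm_le_of_entry_le zero_le_one fun i j => entry_norm_bound_of_unitary hA i j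
  rwa [mul_one] at h

end SkewHermitian

/-! ### The cut-off vector field and the global flow on a finite lattice -/

section Finite

variable {d : ℕ} {R : Type*} [AddGroup R] [One R] {N : ℕ}

omit [AddGroup R] [One R] in
/-- A unitary link field on a finite lattice has sup-Frobenius norm `≤ N`. [folklore] -/
theorem linkField_norm_le [Fintype R] {V : MatrixLinkField d R N}
    (hV : ∀ e, V e ∈ unitaryGroup (Fin N) ℂ) : ‖V‖ ≤ N :=
  (pi_norm_le_iff_of_nonneg (Nat.cast_nonneg N)).2 fun e => norm_le_of_mem_unitaryGroup (hV e)

/-- **The cut-off vector field.** On a finite lattice there is a real cut-off `χ` with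
`χ = 1` on the ball `‖W‖ ≤ N + 1` (which contains all unitary fields) such that `χ · Z(W)W` is
globally Lipschitz and bounded: take `χ(W) = clamp_{[0,1]}(N + 2 − ‖W‖)`, `1`-Lipschitz, vanishing
off the ball of radius `N + 2`, on which the field of (1.4) is bounded by `2d(N+2)⁵` and
`10d(N+2)⁴`-Lipschitz (`norm_wilsonFlowField_le`, `norm_wilsonFlowField_sub_le`). [folklore] -/
theorem exists_lipschitz_cutoff [Fintype R] (H : Set (Matrix (Fin N) (Fin N) ℂ)) :
    ∃ (χ : MatrixLinkField d R N → ℝ) (K C : ℝ≥0),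
      LipschitzWith K (fun W => χ W • wilsonFlowField H W) ∧
      (∀ W, ‖χ W • wilsonFlowField H W‖ ≤ C) ∧
      ∀ W : MatrixLinkField d R N, ‖W‖ ≤ N + 1 → χ W = 1 := by
  obtain ⟨b, hb⟩ : ∃ b : ℝ, b = N + 2 := ⟨_, rfl⟩
  have hb0 : 0 ≤ b := by rw [hb]; positivity
  obtain ⟨χ, hχ⟩ : ∃ χ : MatrixLinkField d R N → ℝ, ∀ W, χ W = max 0 (min 1 (b - ‖W‖)) :=
    ⟨_, fun _ => rfl⟩
  have hχabs : ∀ W, |χ W| ≤ 1 := fun W => by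
    rw [hχ]
    exact abs_le.2 ⟨by linarith [le_max_left (0 : ℝ) (min 1 (b - ‖W‖))],
      max_le zero_le_one (min_le_left _ _)⟩
  have hχzero : ∀ W, b ≤ ‖W‖ → χ W = 0 := fun W hW => by
    rw [hχ]
    exact max_eq_left ((min_le_right _ _).trans (by linarith))
  have hχone : ∀ W : MatrixLinkField d R N, ‖W‖ ≤ N + 1 → χ W = 1 := fun W hW => by
    rw [hχ, min_eq_left (by linarith), max_eq_right zero_le_one]
  have hχlip : ∀ W W', |χ W - χ W'| ≤ ‖W - W'‖ := fun W W' => by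
    have h1 : |χ W - χ W'| ≤ |min 1 (b - ‖W‖) - min 1 (b - ‖W'‖)| := by
      have h := abs_max_sub_max_le_max (0 : ℝ) (min 1 (b - ‖W‖)) 0 (min 1 (b - ‖W'‖))
      rwa [sub_self, abs_zero,
        max_eq_right (abs_nonneg (min 1 (b - ‖W‖) - min 1 (b - ‖W'‖))), ← hχ, ← hχ] at h
    have h2 : |min 1 (b - ‖W‖) - min 1 (b - ‖W'‖)| ≤ |(b - ‖W‖) - (b - ‖W'‖)| := by
      have h := abs_min_sub_min_le_max (1 : ℝ) (b - ‖W‖) 1 (b - ‖W'‖)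
      rwa [sub_self, abs_zero, max_eq_right (abs_nonneg ((b - ‖W‖) - (b - ‖W'‖)))] at h
    calc |χ W - χ W'| ≤ |(b - ‖W‖) - (b - ‖W'‖)| := h1.trans h2
      _ = |‖W'‖ - ‖W‖| := by rw [sub_sub_sub_cancel_left]
      _ ≤ ‖W' - W‖ := abs_norm_sub_norm_le _ _
      _ = ‖W - W'‖ := norm_sub_rev _ _
  -- bounds for the true field on the ball of radius `b`
  have hC0 : (0 : ℝ) ≤ 2 * d * b ^ 5 :=
    mul_nonneg (mul_nonneg zero_le_two (Nat.cast_nonneg _)) (pow_nonneg hb0 _)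
  have hK0 : (0 : ℝ) ≤ 10 * d * b ^ 4 :=
    mul_nonneg (mul_nonneg (by norm_num) (Nat.cast_nonneg _)) (pow_nonneg hb0 _)
  have hFbd : ∀ W : MatrixLinkField d R N, ‖W‖ ≤ b →
      ‖wilsonFlowField H W‖ ≤ 2 * d * b ^ 5 := fun W hW =>
    (pi_norm_le_iff_of_nonneg hC0).2 fun e =>
      norm_wilsonFlowField_le H (fun e' => (norm_le_pi_norm W e').trans hW) e
  have hFlip : ∀ W W' : MatrixLinkField d R N, ‖W‖ ≤ b → ‖W'‖ ≤ b →
      ‖wilsonFlowField H W - wilsonFlowField H W'‖ ≤ 10 * d * b ^ 4 * ‖W - W'‖ :=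
    fun W W' hW hW' =>
    (pi_norm_le_iff_of_nonneg (mul_nonneg hK0 (norm_nonneg _))).2 fun e =>
      norm_wilsonFlowField_sub_le H (fun e' => (norm_le_pi_norm W e').trans hW)
        (fun e' => (norm_le_pi_norm W' e').trans hW') (fun e' => norm_le_pi_norm (W - W') e') e
  -- the one-sided global estimate
  have key : ∀ W W' : MatrixLinkField d R N, ‖W‖ ≤ b →
      ‖χ W • wilsonFlowField H W - χ W' • wilsonFlowField H W'‖ ≤
        (2 * d * b ^ 5 + 10 * d * b ^ 4) * ‖W - W'‖ := by
    intro W W' hW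
    rcases le_or_gt ‖W'‖ b with hW' | hW'
    · have hsplit : χ W • wilsonFlowField H W - χ W' • wilsonFlowField H W' =
          (χ W - χ W') • wilsonFlowField H W +
            χ W' • (wilsonFlowField H W - wilsonFlowField H W') := by
        rw [sub_smul, smul_sub]; abel
      rw [hsplit]
      calc _ ≤ ‖(χ W - χ W') • wilsonFlowField H W‖ +
            ‖χ W' • (wilsonFlowField H W - wilsonFlowField H W')‖ := norm_add_le _ _
        _ = |χ W - χ W'| * ‖wilsonFlowField H W‖ +
            |χ W'| * ‖wilsonFlowField H W - wilsonFlowField H W'‖ := by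
            rw [norm_smul, norm_smul, Real.norm_eq_abs, Real.norm_eq_abs]
        _ ≤ ‖W - W'‖ * (2 * d * b ^ 5) + 1 * (10 * d * b ^ 4 * ‖W - W'‖) :=
            add_le_add (mul_le_mul (hχlip W W') (hFbd W hW) (norm_nonneg _) (norm_nonneg _))
              (mul_le_mul (hχabs W') (hFlip W W' hW hW') (norm_nonneg _) zero_le_one)
        _ = (2 * d * b ^ 5 + 10 * d * b ^ 4) * ‖W - W'‖ := by ring
    · rw [hχzero W' hW'.le, zero_smul, sub_zero, norm_smul, Real.norm_eq_abs]
      have h1 : |χ W| = |χ W - χ W'| := by rw [hχzero W' hW'.le, sub_zero]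
      rw [h1]
      calc |χ W - χ W'| * ‖wilsonFlowField H W‖ ≤ ‖W - W'‖ * (2 * d * b ^ 5) :=
            mul_le_mul (hχlip W W') (hFbd W hW) (norm_nonneg _) (norm_nonneg _)
        _ ≤ (2 * d * b ^ 5 + 10 * d * b ^ 4) * ‖W - W'‖ := by
            nlinarith [norm_nonneg (W - W')]
  obtain ⟨K, hK⟩ : ∃ K : ℝ≥0, (K : ℝ) = 2 * d * b ^ 5 + 10 * d * b ^ 4 :=
    ⟨⟨_, add_nonneg hC0 hK0⟩, rfl⟩
  obtain ⟨C, hC⟩ : ∃ C : ℝ≥0, (C : ℝ) = 2 * d * b ^ 5 := ⟨⟨_, hC0⟩, rfl⟩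
  refine ⟨χ, K, C, ?_, ?_, hχone⟩
  · refine LipschitzWith.of_dist_le_mul fun W W' => ?_
    rw [dist_eq_norm, dist_eq_norm, hK]
    rcases le_or_gt ‖W‖ b with hW | hW
    · exact key W W' hW
    · rcases le_or_gt ‖W'‖ b with hW' | hW'
      · rw [norm_sub_rev, norm_sub_rev W]
        exact key W' W hW'
      · rw [hχzero W hW.le, hχzero W' hW'.le, zero_smul, zero_smul, sub_zero, norm_zero]
        exact mul_nonneg (add_nonneg hC0 hK0) (norm_nonneg _)
  · intro W
    rw [hC]
    rcases le_or_gt ‖W‖ b with hW | hW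
    · rw [norm_smul, Real.norm_eq_abs]
      calc |χ W| * ‖wilsonFlowField H W‖ ≤ 1 * (2 * d * b ^ 5) :=
            mul_le_mul (hχabs W) (hFbd W hW) (norm_nonneg _) zero_le_one
        _ = 2 * d * b ^ 5 := one_mul _
    · rw [hχzero W hW.le, zero_smul, norm_zero]; exact hC0

/-- **Global existence, unitarity and continuity of the flow on a finite lattice, for `H ⊆ U(N)`.**
There is a map `Ψ : V ↦ (t ↦ V_t)` which is a global Wilson flow line (1.4) from every unitary
link field `V`, unitary at all times, and Lipschitz (hence continuous) in `V` on the unitary fields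
at each fixed time. Construction: Picard–Lindelöf for the cut-off field on `[−T, T]` for every `T`
(Lipschitz dependence on the initial point included), invariance of the unitary fields (so the
cut-off is inactive), patching in `T` by uniqueness. [cite: Luscher2010, §1 p. 2] -/
theorem exists_unitary_wilsonFlowLine [Fintype R] {H : Set (Matrix (Fin N) (Fin N) ℂ)}
    (hH : ∀ A ∈ H, A ∈ unitaryGroup (Fin N) ℂ) :
    ∃ Ψ : MatrixLinkField d R N → ℝ → MatrixLinkField d R N,
      (∀ V : MatrixLinkField d R N, (∀ e, V e ∈ unitaryGroup (Fin N) ℂ) →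
        IsWilsonFlowLine H V (Ψ V) ∧ ∀ t e, Ψ V t e ∈ unitaryGroup (Fin N) ℂ) ∧
      ∀ t : ℝ, ContinuousOn (fun V => Ψ V t)
        {V : MatrixLinkField d R N | ∀ e, V e ∈ unitaryGroup (Fin N) ℂ} := by
  obtain ⟨χ, K, C, hlip, hbd, hχ1⟩ := exists_lipschitz_cutoff (d := d) (R := R) (N := N) H
  obtain ⟨Gf, hGf⟩ : ∃ Gf : MatrixLinkField d R N → MatrixLinkField d R N,
      Gf = fun W => χ W • wilsonFlowField H W := ⟨_, rfl⟩
  have hlip' : LipschitzWith K Gf := hGf ▸ hlip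
  have hbd' : ∀ W, ‖Gf W‖ ≤ C := fun W => by rw [hGf]; exact hbd W
  -- Picard–Lindelöf on `[-T, T]`, ball of initial points of radius `N` about `0`
  have h0T : ∀ T : ℝ≥0, (0 : ℝ) ∈ Icc (-(T : ℝ)) T := fun T => ⟨neg_nonpos.2 T.2, T.2⟩
  have hPL : ∀ T : ℝ≥0, IsPicardLindelof (fun _ : ℝ => Gf) (tmin := -(T : ℝ)) (tmax := T)
      ⟨0, h0T T⟩ 0 ((N : ℝ≥0) + C * T) N C K := fun T => by
    refine IsPicardLindelof.of_time_independent (fun W _ => hbd' W) hlip'.lipschitzOnWith ?_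
    have hmax : max ((T : ℝ) - 0) (0 - -(T : ℝ)) = T := by simp
    rw [hmax]; push_cast; linarith
  choose α hα using fun T : ℝ≥0 =>
    (hPL T).exists_forall_mem_closedBall_eq_hasDerivWithinAt_lipschitzOnWith
  have hball : ∀ V : MatrixLinkField d R N, (∀ e, V e ∈ unitaryGroup (Fin N) ℂ) →
      V ∈ closedBall (0 : MatrixLinkField d R N) ((N : ℝ≥0) : ℝ) := fun V hV => by
    rw [mem_closedBall, dist_zero_right, NNReal.coe_natCast]; exact linkField_norm_le hV
  have hα0 : ∀ (T : ℝ≥0) (V : MatrixLinkField d R N), (∀ e, V e ∈ unitaryGroup (Fin N) ℂ) →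
      α T V 0 = V :=
    fun T V hV => ((hα T).1 V (hball V hV)).1
  have hαd : ∀ (T : ℝ≥0) (V : MatrixLinkField d R N), (∀ e, V e ∈ unitaryGroup (Fin N) ℂ) →
      ∀ t ∈ Icc (-(T : ℝ)) T, HasDerivWithinAt (α T V) (Gf (α T V t)) (Icc (-(T : ℝ)) T) t :=
    fun T V hV => ((hα T).1 V (hball V hV)).2
  -- invariance of the unitary fields
  have hαu : ∀ (T : ℝ≥0) (V : MatrixLinkField d R N), (∀ e, V e ∈ unitaryGroup (Fin N) ℂ) →
      ∀ t ∈ Icc (-(T : ℝ)) T, ∀ e, α T V t e ∈ unitaryGroup (Fin N) ℂ := by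
    intro T V hV t ht e
    refine mem_unitaryGroup_of_hasDerivWithinAt (A := fun s => α T V s e)
      (X := fun s => χ (α T V s) • wilsonFlowGenerator H (α T V s) e) (h0T T)
      (fun s hs => ?_) (fun s _ => ?_) ?_ ht
    · have h := (hasDerivWithinAt_pi.1 (hαd T V hV s hs)) e
      rw [hGf] at h
      simp only [Pi.smul_apply] at h
      rwa [wilsonFlowField, ← smul_mul_assoc] at h
    · rw [conjTranspose_smul, star_trivial, conjTranspose_wilsonFlowGenerator hH, smul_neg]
    · rw [hα0 T V hV]; exact hV e
  -- so the cut-off is inactive: the local flows solve the true equation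
  have hαF : ∀ (T : ℝ≥0) (V : MatrixLinkField d R N), (∀ e, V e ∈ unitaryGroup (Fin N) ℂ) →
      ∀ t ∈ Icc (-(T : ℝ)) T,
        HasDerivWithinAt (α T V) (wilsonFlowField H (α T V t)) (Icc (-(T : ℝ)) T) t := by
    intro T V hV t ht
    have h := hαd T V hV t ht
    have h1 : χ (α T V t) = 1 :=
      hχ1 _ ((linkField_norm_le (hαu T V hV t ht)).trans (le_add_of_nonneg_right zero_le_one))
    rw [hGf] at h
    simp only at h
    rwa [h1, one_smul] at h
  -- consistency of the local flows
  have hcons : ∀ V : MatrixLinkField d R N, (∀ e, V e ∈ unitaryGroup (Fin N) ℂ) →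
      ∀ {T₁ T₂ : ℝ≥0}, (0 : ℝ) < T₁ → T₁ ≤ T₂ →
        EqOn (α T₁ V) (α T₂ V) (Icc (-(T₁ : ℝ)) T₁) := by
    intro V hV T₁ T₂ h0 h12
    have h12' : (T₁ : ℝ) ≤ T₂ := h12
    refine ODE_solution_unique_of_mem_Icc (v := fun _ => Gf) (s := fun _ => univ) (K := K)
      (t₀ := 0) (fun _ _ => hlip'.lipschitzOnWith) ⟨by linarith, h0⟩ ?_ ?_ (fun _ _ => trivial)
      ?_ ?_ (fun _ _ => trivial) ?_
    · exact HasDerivWithinAt.continuousOn fun t ht => hαd T₁ V hV t ht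
    · intro t ht
      exact (hαd T₁ V hV t (Ioo_subset_Icc_self ht)).hasDerivAt (Icc_mem_nhds ht.1 ht.2)
    · exact (HasDerivWithinAt.continuousOn fun t ht => hαd T₂ V hV t ht).mono
        (Icc_subset_Icc (by linarith) h12')
    · intro t ht
      have ht' : t ∈ Ioo (-(T₂ : ℝ)) T₂ := ⟨by linarith [ht.1], lt_of_lt_of_le ht.2 h12'⟩
      exact (hαd T₂ V hV t (Ioo_subset_Icc_self ht')).hasDerivAt (Icc_mem_nhds ht'.1 ht'.2)
    · rw [hα0 T₁ V hV, hα0 T₂ V hV]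
  -- the global flow line: at time `t`, the local flow on `[-(|t|+1), |t|+1]`
  obtain ⟨Tof, hTof⟩ : ∃ Tof : ℝ → ℝ≥0, ∀ t, (Tof t : ℝ) = |t| + 1 :=
    ⟨fun t => ⟨|t| + 1, by positivity⟩, fun _ => rfl⟩
  have hmemT : ∀ t, t ∈ Icc (-(Tof t : ℝ)) (Tof t) := fun t => by
    rw [hTof]; exact ⟨by linarith [neg_abs_le t], by linarith [le_abs_self t]⟩
  have hloc : ∀ V : MatrixLinkField d R N, (∀ e, V e ∈ unitaryGroup (Fin N) ℂ) →
      ∀ t : ℝ, ∃ T : ℝ≥0, |t| + 2 = (T : ℝ) ∧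
        ∀ s, |s - t| < 1 → α (Tof s) V s = α T V s := by
    intro V hV t
    refine ⟨⟨|t| + 2, by positivity⟩, rfl, fun s hs => ?_⟩
    have hTs : (0 : ℝ) < Tof s := by rw [hTof]; positivity
    have hle : Tof s ≤ ⟨|t| + 2, by positivity⟩ := by
      rw [← NNReal.coe_le_coe, hTof]
      show |s| + 1 ≤ |t| + 2
      linarith [abs_sub_abs_le_abs_sub s t]
    exact hcons V hV hTs hle (hmemT s)
  refine ⟨fun V t => α (Tof t) V t, fun V hV => ⟨⟨hα0 _ V hV, fun t e i j => ?_⟩,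
    fun t e => hαu _ V hV t (hmemT t) e⟩, fun t => ?_⟩
  · obtain ⟨T, hT, hagree⟩ := hloc V hV t
    have htT : t ∈ Ioo (-(T : ℝ)) T := by
      rw [← hT]; exact ⟨by linarith [neg_abs_le t], by linarith [le_abs_self t]⟩
    have hder : HasDerivAt (α T V) (wilsonFlowField H (α T V t)) t :=
      (hαF T V hV t (Ioo_subset_Icc_self htT)).hasDerivAt (Icc_mem_nhds htT.1 htT.2)
    have heq : (fun s => α (Tof s) V s) =ᶠ[𝓝 t] α T V := by
      filter_upwards [Metric.ball_mem_nhds t one_pos] with s hs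
      exact hagree s (by rwa [Metric.mem_ball, Real.dist_eq] at hs)
    have hder' : HasDerivAt (fun s => α (Tof s) V s) (wilsonFlowField H (α (Tof t) V t)) t := by
      rw [hagree t (by simp)]
      exact hder.congr_of_eventuallyEq heq
    exact hasDerivAt_apply_entry ((hasDerivAt_pi.1 hder') e) i j
  · obtain ⟨L', hL'⟩ := (hα (Tof t)).2
    exact ((hL' t (hmemT t)).continuousOn).mono fun V hV => hball V hV

/-- **Global existence of the Wilson flow line on a finite lattice** (Lüscher, p. 2): for
`H ⊆ U(N)` and unitary initial link matrices `V`, the flow equation (1.4) has a global flow line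
(unique by `IsWilsonFlowLine.unique_of_finite`). In particular the tree's `matrixWilsonFlow H · V`
takes its non-junk branch. [cite: Luscher2010, §1 p. 2] -/
theorem exists_isWilsonFlowLine_of_unitary [Finite R] {H : Set (Matrix (Fin N) (Fin N) ℂ)}
    (hH : ∀ A ∈ H, A ∈ unitaryGroup (Fin N) ℂ) {V : MatrixLinkField d R N}
    (hV : ∀ e, V e ∈ unitaryGroup (Fin N) ℂ) : ∃ Φ, IsWilsonFlowLine H V Φ := by
  haveI : Fintype R := Fintype.ofFinite R
  obtain ⟨Ψ, hΨ, -⟩ := exists_unitary_wilsonFlowLine (d := d) (R := R) hH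
  exact ⟨Ψ V, (hΨ V hV).1⟩

/-- **Unitarity along the flow**: on a finite lattice, for `H ⊆ U(N)` and unitary `V`, every
flowed link matrix `matrixWilsonFlow H t V e` is unitary. [cite: Luscher2010, App. C eq. (C.1)] -/
theorem matrixWilsonFlow_mem_unitaryGroup [Finite R] {H : Set (Matrix (Fin N) (Fin N) ℂ)}
    (hH : ∀ A ∈ H, A ∈ unitaryGroup (Fin N) ℂ) {V : MatrixLinkField d R N}
    (hV : ∀ e, V e ∈ unitaryGroup (Fin N) ℂ) (t : ℝ) (e : (Fin d → R) × Fin d) :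
    matrixWilsonFlow H t V e ∈ unitaryGroup (Fin N) ℂ := by
  haveI : Fintype R := Fintype.ofFinite R
  obtain ⟨Ψ, hΨ, -⟩ := exists_unitary_wilsonFlowLine (d := d) (R := R) hH
  rw [← (hΨ V hV).1.eq_matrixWilsonFlow t]
  exact (hΨ V hV).2 t e

/-- **Continuity of the flow in the initial field**: on a finite lattice, for `H ⊆ U(N)`, the
flow `V ↦ matrixWilsonFlow H t V` at fixed time is continuous on the unitary link fields
(Lipschitz dependence on the data, Grönwall/Picard–Lindelöf). [folklore] -/
theorem continuousOn_matrixWilsonFlow [Finite R] {H : Set (Matrix (Fin N) (Fin N) ℂ)}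
    (hH : ∀ A ∈ H, A ∈ unitaryGroup (Fin N) ℂ) (t : ℝ) :
    ContinuousOn (matrixWilsonFlow H t)
      {V : MatrixLinkField d R N | ∀ e, V e ∈ unitaryGroup (Fin N) ℂ} := by
  haveI : Fintype R := Fintype.ofFinite R
  obtain ⟨Ψ, hΨ, hc⟩ := exists_unitary_wilsonFlowLine (d := d) (R := R) hH
  exact (hc t).congr fun V hV => ((hΨ V hV).1.eq_matrixWilsonFlow t).symm

end Finite

end Literature.MathematicalPhysics.QuantumLattice

end
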